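import Literature.Analysis.FluidPDE.EnskogTestOperator
import HarnessLib

/-!
# The test-side Enskog operator: inline forms, linearity, and the hydrodynamic increment

Topic `Literature/Analysis/FluidPDE`; namespace `Literature.Analysis.FluidPDE`.  Companion of
`EnskogTestOperator.lean` (`enskogTestOperator`, `enskogPairIncrement`), answering the second
definition request `defn-enskogTestOperator-2` (route
AtomisticToContinuum/HydrodynamicLimit/EnskogAdjointDuality; shared with CollisionMeasureChaos and
DenseKineticExpansion).  The notion itself is NOT redefined: it is
`Literature.Analysis.FluidPDE.enskogTestOperator`.  Everything here is proved; no named fact.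

## Why this file

The items `CollisionResidualVanishes`, `AdjointEnskogTestFamily`, `EquilibriumCollisionResidual` of
that route spell the operator inline,
`L φ (x, v) = λ ∫_{S²} ( ∫ max((v − w)·ω, 0) · Y(σ³ρ(x + (ε/2)ω)) · f(x + εω, w) ·`
`  [φ(x, v − ((v − w)·ω)ω) + φ(x + εω, w + ((v − w)·ω)ω) − φ(x, v) − φ(x + εω, w)] dw ) dσ(ω)`.

* `enskogTestOperator_eq_inline`, `enskogPairIncrement_eq_inline`: this is *definitionally*
  `enskogTestOperator G ε λ (fun x ω ↦ Y(σ³ρ(x + (ε/2)ω))) f φ x v` (proofs `rfl`, so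
  `rw [← enskogTestOperator_eq_inline …]`, `change` and `show` all work for a prover facing the
  route text).
* `Geometry.translate_translate_half_neg(_sphere)`, `midpointWeight_exchange`: the midpoint
  `x + (ε/2)ω`, where the route evaluates the contact factor, is invariant under the pair exchange
  `(x, ω) ↦ (x + εω, −ω)` — van Beijeren–Ernst's symmetric location of `Y` (1973), the companion of
  `enskogPairIncrement_exchange` and `hardSphereKernel_swap_neg` in the symmetrisation
  `∫∫ g · Lφ = 2⟨λ Q^E(g, g), φ⟩` / Résibois' `H`-theorem (1978).
* Linearity in the test function: `enskogPairIncrement_add/_sub/_smul`,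
  `enskogTestOperator_smul` (no integrability needed), and `enskogTestOperator_const_vel`
  (functions of the position alone are annihilated).
* The hydrodynamic sector `φ(y, v) = α(y) + ⟪β(y), v⟫ + γ(y)|v|²` of the route's test functions:
  `enskogPairIncrement_eq_sub_of_forall_isCollisionInvariant` (fibrewise collision invariants turn
  the bracket into a difference over the contact distance — the collisional transfer, Soto 2016
  §4.8.2), the exact formula `enskogPairIncrement_quadratic`
  `Δφ = ⟪β(x) − β(x + εω), v′ − v⟫ + (γ(x) − γ(x + εω)) (|v′|² − |v|²)`, and its vanishing at
  `ε = 0` together with the zero-diameter (Boltzmann-bracket) form of the operator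
  (`enskogTestOperator_zero_diam`, `…_zero_diam_eq_zero_of_forall_isCollisionInvariant`).

## References

* R. Soto, *Kinetic Theory and Transport Phenomena*, OUP 2016, §4.8.1 eq. (4.87), §4.8.2
  (collisional transfer). [Soto2016]
* H. van Beijeren, M. H. Ernst, *The modified Enskog equation*, Physica 68 (1973) 437–456
  (symmetric location of the contact pair correlation). [VanbeijerenErnst1973]
* P. Résibois, J. Stat. Phys. 19 (1978) 593–609 (symmetrised weak form). [Resibois1978]
-/

noncomputable section

open MeasureTheory Metric
open scoped InnerProductSpace
open Literature.MathematicalPhysics.KineticTheory (collide hardSphereKernel sphereMeasure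
  IsCollisionInvariant isCollisionInvariant_quadratic)

namespace Literature.Analysis.FluidPDE

variable {d : Type*} [Fintype d] {X : Type*}

/-! ### Inline forms -/

/-- **Inline form of the pair increment**: with the collision law written out,
`Δφ = φ(x, v − ((v−w)·ω)ω) + φ(x + εω, w + ((v−w)·ω)ω) − φ(x, v) − φ(x + εω, w)`
(definitional). [folklore] -/
theorem enskogPairIncrement_eq_inline (G : Geometry d X) (ε : ℝ)
    (φ : X → EuclideanSpace ℝ d → ℝ) (x : X) (v w : EuclideanSpace ℝ d)
    (ω : sphere (0 : EuclideanSpace ℝ d) 1) :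
    enskogPairIncrement G ε φ x v w ω =
      φ x (v - ⟪v - w, (ω : EuclideanSpace ℝ d)⟫_ℝ • (ω : EuclideanSpace ℝ d)) +
        φ (G.translate x (ε • (ω : EuclideanSpace ℝ d)))
          (w + ⟪v - w, (ω : EuclideanSpace ℝ d)⟫_ℝ • (ω : EuclideanSpace ℝ d)) -
        φ x v - φ (G.translate x (ε • (ω : EuclideanSpace ℝ d))) w :=
  rfl

/-- **Inline form of the operator** (the spelling of the route items of EnskogAdjointDuality, with
`hardSphereKernel`, `collide` and `enskogPairIncrement` unfolded):
`L φ (x, v) = λ ∫ ( ∫ max((v−w)·ω, 0) · Y x ω · g(x + εω, w) · [φ(x, v′) + φ(x + εω, w′) − φ(x, v) − φ(x + εω, w)] dw ) dσ(ω)`,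
`v′ = v − ((v−w)·ω)ω`, `w′ = w + ((v−w)·ω)ω`.  Definitional (`rfl`); instantiate
`Y := fun x ω ↦ Y₀ (σ³ ρ (G.translate x ((ε/2) • ω)))` for the midpoint contact weight of the
route (checked against the verbatim `let L := …` of `CollisionResidualVanishes`: after `intro` of
the `let`s, `L N s x v = enskogTestOperator G (ε N) (lam N) (fun x ω ↦ Y (σ ^ 3 * ρ s
(G.translate x ((ε N / 2) • ω)))) (f s) (φ N s) x v` holds by `rfl`).  When rewriting
right-to-left give `Y` explicitly (its occurrence `Y x ω` is a higher-order pattern).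
[cite: Soto2016, §4.8.1 eq. (4.87)] -/
theorem enskogTestOperator_eq_inline (G : Geometry d X) (ε rate : ℝ)
    (Y : X → sphere (0 : EuclideanSpace ℝ d) 1 → ℝ) (g φ : X → EuclideanSpace ℝ d → ℝ)
    (x : X) (v : EuclideanSpace ℝ d) :
    enskogTestOperator G ε rate Y g φ x v =
      rate * ∫ ω : sphere (0 : EuclideanSpace ℝ d) 1, (∫ w : EuclideanSpace ℝ d,
        max ⟪v - w, (ω : EuclideanSpace ℝ d)⟫_ℝ 0 * Y x ω *
          g (G.translate x (ε • (ω : EuclideanSpace ℝ d))) w *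
          (φ x (v - ⟪v - w, (ω : EuclideanSpace ℝ d)⟫_ℝ • (ω : EuclideanSpace ℝ d)) +
            φ (G.translate x (ε • (ω : EuclideanSpace ℝ d)))
              (w + ⟪v - w, (ω : EuclideanSpace ℝ d)⟫_ℝ • (ω : EuclideanSpace ℝ d)) -
            φ x v - φ (G.translate x (ε • (ω : EuclideanSpace ℝ d))) w)) ∂sphereMeasure :=
  rfl

/-! ### The contact midpoint under the pair exchange -/

/-- **The contact midpoint is exchange-invariant**: `(x + εu) + (ε/2)(−u) = x + (ε/2)u` for the
translation action of any geometry — seen from the partner at `x + εω` with reversed impact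
direction `−ω`, the midpoint `x + (ε/2)ω` (where the route evaluates the contact factor
`Y(σ³ρ(·))`, van Beijeren–Ernst 1973) is the same point. [folklore] -/
theorem Geometry.translate_translate_half_neg (G : Geometry d X) (ε : ℝ) (x : X)
    (u : EuclideanSpace ℝ d) :
    G.translate (G.translate x (ε • u)) ((ε / 2) • (-u)) = G.translate x ((ε / 2) • u) := by
  rw [G.translate_add]
  congr 1
  module

/-- Sphere version of `Geometry.translate_translate_half_neg`: for `ω ∈ S^{d-1}`,
`(x + εω) + (ε/2)·(−ω) = x + (ε/2)ω`, with `−ω` the antipode in the sphere. [folklore] -/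
theorem Geometry.translate_translate_half_neg_sphere (G : Geometry d X) (ε : ℝ) (x : X)
    (ω : sphere (0 : EuclideanSpace ℝ d) 1) :
    G.translate (G.translate x (ε • (ω : EuclideanSpace ℝ d)))
        ((ε / 2) • ((-ω : sphere (0 : EuclideanSpace ℝ d) 1) : EuclideanSpace ℝ d)) =
      G.translate x ((ε / 2) • (ω : EuclideanSpace ℝ d)) := by
  rw [coe_neg_sphere]
  exact G.translate_translate_half_neg ε x ω

/-- **Exchange symmetry of a midpoint contact weight**: a weight of the form
`Y x ω = F(x + (ε/2)ω)` satisfies `Y (x + εω) (−ω) = Y x ω`. [folklore] -/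
theorem midpointWeight_exchange {Z : Type*} (G : Geometry d X) (ε : ℝ) (F : X → Z) (x : X)
    (ω : sphere (0 : EuclideanSpace ℝ d) 1) :
    F (G.translate (G.translate x (ε • (ω : EuclideanSpace ℝ d)))
        ((ε / 2) • ((-ω : sphere (0 : EuclideanSpace ℝ d) 1) : EuclideanSpace ℝ d))) =
      F (G.translate x ((ε / 2) • (ω : EuclideanSpace ℝ d))) := by
  rw [G.translate_translate_half_neg_sphere]

/-! ### Linearity in the test function -/

/-- The pair increment is additive in the test function. [folklore] -/
theorem enskogPairIncrement_add (G : Geometry d X) (ε : ℝ) (φ ψ : X → EuclideanSpace ℝ d → ℝ)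
    (x : X) (v w : EuclideanSpace ℝ d) (ω : sphere (0 : EuclideanSpace ℝ d) 1) :
    enskogPairIncrement G ε (φ + ψ) x v w ω =
      enskogPairIncrement G ε φ x v w ω + enskogPairIncrement G ε ψ x v w ω := by
  simp only [enskogPairIncrement, Pi.add_apply]
  ring

/-- The pair increment of a difference of test functions. [folklore] -/
theorem enskogPairIncrement_sub (G : Geometry d X) (ε : ℝ) (φ ψ : X → EuclideanSpace ℝ d → ℝ)
    (x : X) (v w : EuclideanSpace ℝ d) (ω : sphere (0 : EuclideanSpace ℝ d) 1) :
    enskogPairIncrement G ε (φ - ψ) x v w ω =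
      enskogPairIncrement G ε φ x v w ω - enskogPairIncrement G ε ψ x v w ω := by
  simp only [enskogPairIncrement, Pi.sub_apply]
  ring

/-- The pair increment is homogeneous in the test function. [folklore] -/
theorem enskogPairIncrement_smul (G : Geometry d X) (ε c : ℝ) (φ : X → EuclideanSpace ℝ d → ℝ)
    (x : X) (v w : EuclideanSpace ℝ d) (ω : sphere (0 : EuclideanSpace ℝ d) 1) :
    enskogPairIncrement G ε (c • φ) x v w ω = c * enskogPairIncrement G ε φ x v w ω := by
  simp only [enskogPairIncrement, Pi.smul_apply, smul_eq_mul]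
  ring

/-- A test function of the position alone has zero increment (both particles keep their
positions in a collision). [folklore] -/
theorem enskogPairIncrement_eq_zero_of_const_vel (G : Geometry d X) (ε : ℝ) (a : X → ℝ) (x : X)
    (v w : EuclideanSpace ℝ d) (ω : sphere (0 : EuclideanSpace ℝ d) 1) :
    enskogPairIncrement G ε (fun y _ => a y) x v w ω = 0 := by
  simp only [enskogPairIncrement]
  ring

/-- **The operator is homogeneous in the test function**, `L (c φ) = c L φ`, with no integrability
assumption (constants leave Bochner integrals unconditionally). [folklore] -/
theorem enskogTestOperator_smul (G : Geometry d X) (ε rate c : ℝ)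
    (Y : X → sphere (0 : EuclideanSpace ℝ d) 1 → ℝ) (g φ : X → EuclideanSpace ℝ d → ℝ)
    (x : X) (v : EuclideanSpace ℝ d) :
    enskogTestOperator G ε rate Y g (c • φ) x v = c * enskogTestOperator G ε rate Y g φ x v := by
  simp only [enskogTestOperator, enskogPairIncrement_smul]
  have h : ∀ (ω : sphere (0 : EuclideanSpace ℝ d) 1),
      (∫ w, hardSphereKernel (v, w) ω * Y x ω *
          g (G.translate x (ε • (ω : EuclideanSpace ℝ d))) w *
          (c * enskogPairIncrement G ε φ x v w ω)) =
        c * ∫ w, hardSphereKernel (v, w) ω * Y x ω *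
          g (G.translate x (ε • (ω : EuclideanSpace ℝ d))) w * enskogPairIncrement G ε φ x v w ω := by
    intro ω
    rw [← integral_const_mul]
    congr 1
    funext w
    ring
  simp_rw [h, integral_const_mul]
  ring

/-- A test function of the position alone is annihilated: `L a = 0` for `φ(x, v) = a(x)`.
[folklore] -/
theorem enskogTestOperator_const_vel (G : Geometry d X) (ε rate : ℝ)
    (Y : X → sphere (0 : EuclideanSpace ℝ d) 1 → ℝ) (g : X → EuclideanSpace ℝ d → ℝ) (a : X → ℝ) :
    enskogTestOperator G ε rate Y g (fun y _ => a y) = 0 := by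
  funext x v
  simp [enskogTestOperator, enskogPairIncrement_eq_zero_of_const_vel]

/-! ### Fibrewise collision invariants: the increment is a difference over the contact distance -/

/-- **Fibrewise collision invariants.** If every velocity fibre `φ(y, ·)` is a collision invariant
(e.g. `φ(y, v) = α(y) + β(y)·v + γ(y)|v|²` with `y`-dependent coefficients), the pair increment is
the difference of `φ(·, v′) − φ(·, v)` over the contact distance:
`Δφ = [φ(x, v′) − φ(x + εω, v′)] − [φ(x, v) − φ(x + εω, v)]` (use the invariance of the fibre at
`x + εω`).  This is why hydrodynamic increments are `O(ε ‖∇_x φ‖)` — the collisional transfer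
(Soto 2016 §4.8.2). [folklore] -/
theorem enskogPairIncrement_eq_sub_of_forall_isCollisionInvariant (G : Geometry d X) (ε : ℝ)
    {φ : X → EuclideanSpace ℝ d → ℝ} (hφ : ∀ y, IsCollisionInvariant (φ y)) (x : X)
    (v w : EuclideanSpace ℝ d) (ω : sphere (0 : EuclideanSpace ℝ d) 1) :
    enskogPairIncrement G ε φ x v w ω =
      (φ x (collide ω (v, w)).1 -
          φ (G.translate x (ε • (ω : EuclideanSpace ℝ d))) (collide ω (v, w)).1) -
        (φ x v - φ (G.translate x (ε • (ω : EuclideanSpace ℝ d))) v) := by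
  have h := hφ (G.translate x (ε • (ω : EuclideanSpace ℝ d))) ω (v, w)
  simp only [enskogPairIncrement]
  linarith

/-- At zero diameter, fibrewise collision invariants have zero increment (the partner sits at the
same point, `x + 0·ω = x`). [folklore] -/
theorem enskogPairIncrement_zero_diam_eq_zero_of_forall_isCollisionInvariant (G : Geometry d X)
    {φ : X → EuclideanSpace ℝ d → ℝ} (hφ : ∀ y, IsCollisionInvariant (φ y)) (x : X)
    (v w : EuclideanSpace ℝ d) (ω : sphere (0 : EuclideanSpace ℝ d) 1) :
    enskogPairIncrement G 0 φ x v w ω = 0 := by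
  rw [enskogPairIncrement_eq_sub_of_forall_isCollisionInvariant G 0 hφ]
  simp

/-- At zero diameter, a test function all of whose velocity fibres are collision invariants is
annihilated by the operator (the Boltzmann-type local conservation laws; at `ε > 0` only the
`O(ε)` collisional transfer survives, `enskogPairIncrement_eq_sub_of_forall_isCollisionInvariant`).
[folklore] -/
theorem enskogTestOperator_zero_diam_eq_zero_of_forall_isCollisionInvariant (G : Geometry d X)
    (rate : ℝ) (Y : X → sphere (0 : EuclideanSpace ℝ d) 1 → ℝ) (g : X → EuclideanSpace ℝ d → ℝ)
    {φ : X → EuclideanSpace ℝ d → ℝ} (hφ : ∀ y, IsCollisionInvariant (φ y)) :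
    enskogTestOperator G 0 rate Y g φ = 0 := by
  funext x v
  simp [enskogTestOperator,
    enskogPairIncrement_zero_diam_eq_zero_of_forall_isCollisionInvariant G hφ]

/-- **The hydrodynamic increment.** For `φ(y, v) = α(y) + ⟪β(y), v⟫ + γ(y) |v|²` (the Euler
sector of the route's test functions) the pair increment is exactly
`⟪β(x) − β(x + εω), v′ − v⟫ + (γ(x) − γ(x + εω)) (|v′|² − |v|²)`, `v′ = (collide ω (v, w)).1`:
differences of the coefficients over the contact distance `εω`, times the momentum and energy
exchanged in the collision. [folklore] -/
theorem enskogPairIncrement_quadratic (G : Geometry d X) (ε : ℝ) (α γ : X → ℝ)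
    (β : X → EuclideanSpace ℝ d) (x : X) (v w : EuclideanSpace ℝ d)
    (ω : sphere (0 : EuclideanSpace ℝ d) 1) :
    enskogPairIncrement G ε (fun y u => α y + ⟪β y, u⟫_ℝ + γ y * ‖u‖ ^ 2) x v w ω =
      ⟪β x - β (G.translate x (ε • (ω : EuclideanSpace ℝ d))), (collide ω (v, w)).1 - v⟫_ℝ +
        (γ x - γ (G.translate x (ε • (ω : EuclideanSpace ℝ d)))) *
          (‖(collide ω (v, w)).1‖ ^ 2 - ‖v‖ ^ 2) := by
  rw [enskogPairIncrement_eq_sub_of_forall_isCollisionInvariant G ε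
    (fun y => isCollisionInvariant_quadratic (α y) (γ y) (β y))]
  simp only [inner_sub_left, inner_sub_right]
  ring

/-- In particular the hydrodynamic increment vanishes at zero diameter. [folklore] -/
theorem enskogPairIncrement_quadratic_zero_diam (G : Geometry d X) (α γ : X → ℝ)
    (β : X → EuclideanSpace ℝ d) (x : X) (v w : EuclideanSpace ℝ d)
    (ω : sphere (0 : EuclideanSpace ℝ d) 1) :
    enskogPairIncrement G 0 (fun y u => α y + ⟪β y, u⟫_ℝ + γ y * ‖u‖ ^ 2) x v w ω = 0 :=
  enskogPairIncrement_zero_diam_eq_zero_of_forall_isCollisionInvariant G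
    (fun y => isCollisionInvariant_quadratic (α y) (γ y) (β y)) x v w ω

/-- **Zero diameter: the Boltzmann-type test operator.** At `ε = 0` the partner is drawn at the
same point and the bracket is the Boltzmann one:
`L φ (x, v) = λ ∫∫ ((v−w)·ω)₊ Y x ω g(x, w) [φ(x, v′) + φ(x, w′) − φ(x, v) − φ(x, w)] dw dσ(ω)`.
[folklore] -/
theorem enskogTestOperator_zero_diam (G : Geometry d X) (rate : ℝ)
    (Y : X → sphere (0 : EuclideanSpace ℝ d) 1 → ℝ) (g φ : X → EuclideanSpace ℝ d → ℝ)
    (x : X) (v : EuclideanSpace ℝ d) :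
    enskogTestOperator G 0 rate Y g φ x v =
      rate * ∫ ω : sphere (0 : EuclideanSpace ℝ d) 1, (∫ w : EuclideanSpace ℝ d,
        hardSphereKernel (v, w) ω * Y x ω * g x w *
          (φ x (collide ω (v, w)).1 + φ x (collide ω (v, w)).2 - φ x v - φ x w)) ∂sphereMeasure := by
  simp [enskogTestOperator, enskogPairIncrement]

end Literature.Analysis.FluidPDE
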